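import Literature.RepresentationTheory.HeisenbergGroup.HeisenbergPairUniqueness
import Literature.RepresentationTheory.HeisenbergGroup.DualLatticePairFiniteAdelic
import HarnessLib

/-!
# Uniqueness of the irreducible unitary representation of `H(W_∞) · H(W_fin)` with `W_fin` over a restricted product of
# non-archimedean fields — the abstract global uniqueness of `ρ_ψ` from LOCAL data

Topic `RepresentationTheory/HeisenbergGroup`; namespace `Literature.RepresentationTheory.HeisenbergGroup`.  KERNEL ONLY:
theorems; no definition, no named fact, no record, no `sorry`.

[GelbartRogawski1991, §3.1 p. 454 L19–21]: "let `ρ_ψ` be an irreducible unitary representation of `H_𝐀(W)` with central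
character `ψ` (`ρ_ψ` is unique up to isomorphism)".  This file states and proves the uniqueness for the SHAPE of
`H_𝐀(W)` with every analytic and lattice-theoretic input discharged from local data, in the abstraction used throughout
the tree's [GR91] files (places = an index type, `F_v` = non-archimedean normed fields with compact closed balls):

* archimedean part: a representation `π` of `Heisenberg B`, `B : X →ₗ[R] X →ₗ[R] R` over a commutative `ℝ`-algebra `R`
  (`F ⊗ ℝ`), on a Hilbert space by isometries, continuous orbit maps on the finite-dimensional real normed `X`, central
  character `𝐞 ∘ ℓ` with `ℓ` onto and `ℓ(B − Bᵀ)` non-degenerate (`ψ_v ≠ 1` for `v ∣ ∞`);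
* finite part: `P = Πʳ_v [F_v, A_v]` (Mathlib's restricted product; `A_v` the closed unit balls), local characters `ψ_v`
  continuous, non-trivial, trivial on `A_v` and unramified (`𝔠_{ψ_v} = 𝒪_v`) for almost all `v`, each `F_v` with a
  non-zero element of norm `< 1`; `ψ_fin = ∏_v ψ_v` (`RestrictedPair.prodChar`); a commuting representation `τ` of the
  polarised Heisenberg group `Heisenberg (polar (x · y))` over `Pⁿ × Pⁿ` by isometries, continuous orbit maps, central
  character `ψ_fin`;
* `(E, π, τ)` jointly irreducible, `E ≠ 0`.

THEOREM (**`exists_linearIsometryEquiv_of_irreducible_adelicShape`**): two such triples are unitarily equivalent by a `U`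
intertwining both `π` and `τ`; `U` is unique up to `S¹` (**`linearIsometryEquiv_unique_of_adelicShape`**).  Proof:
`HeisenbergPairUniqueness.lean` with the dual lattice pair `((∏𝒪_v)ⁿ, (∏𝔠_v)ⁿ)` and its shrinking unit scalings from
`DualLatticePairFiniteAdelic.lean`.  What separates this from the adelic `ρ_ψ` of the tree's `Prop311AsPrinted` is
the IDENTIFICATION of Mathlib's `AdeleRing (𝓞 F) F = InfiniteAdeleRing F × FiniteAdeleRing (𝓞 F) F`, `𝐀 ⊗_F V`,
`v.adicCompletion F` with this shape (bookkeeping; `HeisenbergCoboundary.lean` supplies the group isomorphisms) and the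
number-theoretic fact that a non-trivial character of `𝐀/F` has non-trivial, almost everywhere unramified local
components.  Nothing of the cited sources is asserted.

## References
* [GelbartRogawski1991] S. Gelbart, J. Rogawski, Invent. Math. 105 (1991), §3.1 p. 454 L17–27.
* [Weil1964] A. Weil, Acta Math. 111 (1964), Chap. III n° 37–39.
* [vonNeumann1931] J. von Neumann, Math. Ann. 104 (1931), §5.
-/

set_option autoImplicit false

noncomputable section

open Set Filter Topology Function
open scoped Pointwise RestrictedProduct FourierTransform

namespace Literature.RepresentationTheory.HeisenbergGroup

open RestrictedPair

variable {R : Type*} [CommRing R] [Algebra ℝ R]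
  {X : Type*} [NormedAddCommGroup X] [NormedSpace ℝ X] [FiniteDimensional ℝ X] [Module R X] [IsScalarTower ℝ R X]
  (B : X →ₗ[R] X →ₗ[R] R) (ℓ : R →ₗ[ℝ] ℝ)
  {ι : Type*} [DecidableEq ι] {F : ι → Type*} [∀ i, NormedField (F i)] [∀ i, IsUltrametricDist (F i)]
  [∀ i, ProperSpace (F i)] {S : ι → Type*} [∀ i, SetLike (S i) (F i)] [∀ i, SubringClass (S i) (F i)] {A : ∀ i, S i}
  (hA : ∀ i, (A i : Set (F i)) = Metric.closedBall 0 1)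
  (ψ : ∀ i, AddChar (F i) Circle) (hψc : ∀ i, Continuous (ψ i)) (hψ1 : ∀ i, ∃ t, ψ i t ≠ 1)
  (hψA : ∀ᶠ i in cofinite, ∀ a ∈ A i, ψ i a = 1)
  (hunr : ∀ᶠ i in cofinite, (mulDual (ψ i) : Set (F i)) = Metric.closedBall 0 1)
  (hsmall : ∀ i, ∃ c : F i, 0 < ‖c‖ ∧ ‖c‖ < 1)
  {n : Type*} [Fintype n] [DecidableEq n]

/-- shorthand in statements: the finite-adelic ring `P = Πʳ_v [F_v, A_v]`. -/
local notation "P" => Πʳ i, [F i, A i]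

include hA hψc hψ1 hunr hsmall

/-- **Uniqueness of the irreducible unitary representation of `H(W_∞) · H(W_fin)` from local data.**  See the module
docstring for the data; conclusion: a unitary `U : E₁ ≃ₗᵢ[ℂ] E₂` with `U (π₁ h v) = π₂ h (U v)` and
`U (τ₁ h' v) = τ₂ h' (U v)`. [cite: vonNeumann1931, §5] -/
theorem exists_linearIsometryEquiv_of_irreducible_adelicShape (hℓ : Function.Surjective ℓ)
    (hs : (realForm B ℓ - (realForm B ℓ).flip).Nondegenerate)
    {E₁ : Type*} [NormedAddCommGroup E₁] [InnerProductSpace ℂ E₁] [CompleteSpace E₁] [Nontrivial E₁]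
    {E₂ : Type*} [NormedAddCommGroup E₂] [InnerProductSpace ℂ E₂] [CompleteSpace E₂] [Nontrivial E₂]
    (π₁ : Representation ℂ (Heisenberg B) E₁) (π₂ : Representation ℂ (Heisenberg B) E₂)
    (τ₁ : Representation ℂ (Heisenberg (polar (Matrix.toLinearMap₂' P (1 : Matrix n n P)))) E₁)
    (τ₂ : Representation ℂ (Heisenberg (polar (Matrix.toLinearMap₂' P (1 : Matrix n n P)))) E₂)
    (h₁πu : ∀ (h : Heisenberg B) (v : E₁), ‖π₁ h v‖ = ‖v‖) (h₂πu : ∀ (h : Heisenberg B) (v : E₂), ‖π₂ h v‖ = ‖v‖)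
    (h₁πc : ∀ v : E₁, Continuous fun y : X => π₁ ⟨y, 0⟩ v) (h₂πc : ∀ v : E₂, Continuous fun y : X => π₂ ⟨y, 0⟩ v)
    (h₁πz : ∀ (t : R) (v : E₁), π₁ (Heisenberg.ofCenter B (Multiplicative.ofAdd t)) v = ((𝐞 (ℓ t) : Circle) : ℂ) • v)
    (h₂πz : ∀ (t : R) (v : E₂), π₂ (Heisenberg.ofCenter B (Multiplicative.ofAdd t)) v = ((𝐞 (ℓ t) : Circle) : ℂ) • v)
    (h₁τu : ∀ (h : Heisenberg (polar (Matrix.toLinearMap₂' P (1 : Matrix n n P)))) (v : E₁), ‖τ₁ h v‖ = ‖v‖)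
    (h₂τu : ∀ (h : Heisenberg (polar (Matrix.toLinearMap₂' P (1 : Matrix n n P)))) (v : E₂), ‖τ₂ h v‖ = ‖v‖)
    (h₁τc : ∀ v : E₁, Continuous fun w : (n → P) × (n → P) => τ₁ ⟨w, 0⟩ v)
    (h₂τc : ∀ v : E₂, Continuous fun w : (n → P) × (n → P) => τ₂ ⟨w, 0⟩ v)
    (h₁τz : ∀ (t : P) (v : E₁), τ₁ (Heisenberg.ofCenter (polar (Matrix.toLinearMap₂' P (1 : Matrix n n P)))
      (Multiplicative.ofAdd t)) v = ((prodChar ψ hψA t : Circle) : ℂ) • v)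
    (h₂τz : ∀ (t : P) (v : E₂), τ₂ (Heisenberg.ofCenter (polar (Matrix.toLinearMap₂' P (1 : Matrix n n P)))
      (Multiplicative.ofAdd t)) v = ((prodChar ψ hψA t : Circle) : ℂ) • v)
    (h₁comm : ∀ (h : Heisenberg B) (h' : Heisenberg (polar (Matrix.toLinearMap₂' P (1 : Matrix n n P)))) (v : E₁),
      π₁ h (τ₁ h' v) = τ₁ h' (π₁ h v))
    (h₂comm : ∀ (h : Heisenberg B) (h' : Heisenberg (polar (Matrix.toLinearMap₂' P (1 : Matrix n n P)))) (v : E₂),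
      π₂ h (τ₂ h' v) = τ₂ h' (π₂ h v))
    (h₁i : ∀ K : Submodule ℂ E₁, IsClosed (K : Set E₁) → (∀ (h : Heisenberg B), ∀ v ∈ K, π₁ h v ∈ K) →
      (∀ (h' : Heisenberg (polar (Matrix.toLinearMap₂' P (1 : Matrix n n P)))), ∀ v ∈ K, τ₁ h' v ∈ K) → K = ⊥ ∨ K = ⊤)
    (h₂i : ∀ K : Submodule ℂ E₂, IsClosed (K : Set E₂) → (∀ (h : Heisenberg B), ∀ v ∈ K, π₂ h v ∈ K) →
      (∀ (h' : Heisenberg (polar (Matrix.toLinearMap₂' P (1 : Matrix n n P)))), ∀ v ∈ K, τ₂ h' v ∈ K) → K = ⊥ ∨ K = ⊤) :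
    ∃ U : E₁ ≃ₗᵢ[ℂ] E₂, (∀ (h : Heisenberg B) (v : E₁), U (π₁ h v) = π₂ h (U v)) ∧
      ∀ (h' : Heisenberg (polar (Matrix.toLinearMap₂' P (1 : Matrix n n P)))) (v : E₁), U (τ₁ h' v) = τ₂ h' (U v) := by
  haveI : Fact (∀ i, IsOpen (A i : Set (F i))) := ⟨isOpen_structureSubring hA⟩
  exact exists_linearIsometryEquiv_of_irreducible_heisenberg_pair B ℓ (Matrix.toLinearMap₂' P (1 : Matrix n n P))
    (prodChar ψ hψA) hℓ hs (isDualLatticePair_integers_conductor_pi hA ψ hψc hψ1 hψA hunr)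
    (exists_units_smul_integers_pi_subset hA hsmall) (exists_units_smul_conductor_pi_subset hA ψ hψc hψ1 hunr hsmall)
    π₁ π₂ τ₁ τ₂ h₁πu h₂πu h₁πc h₂πc h₁πz h₂πz h₁τu h₂τu h₁τc h₂τc h₁τz h₂τz h₁comm h₂comm h₁i h₂i

/-- **the intertwiner is unique up to `S¹`** (the kernel `ℂˣ` of `(g, M_g) ↦ g` for the group of pairs over such a
representation). [cite: vonNeumann1931, §5] -/
theorem linearIsometryEquiv_unique_of_adelicShape (hℓ : Function.Surjective ℓ)
    (hs : (realForm B ℓ - (realForm B ℓ).flip).Nondegenerate)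
    {E₁ : Type*} [NormedAddCommGroup E₁] [InnerProductSpace ℂ E₁] [CompleteSpace E₁] [Nontrivial E₁]
    {E₂ : Type*} [NormedAddCommGroup E₂] [InnerProductSpace ℂ E₂]
    (π₁ : Representation ℂ (Heisenberg B) E₁) (π₂ : Representation ℂ (Heisenberg B) E₂)
    (τ₁ : Representation ℂ (Heisenberg (polar (Matrix.toLinearMap₂' P (1 : Matrix n n P)))) E₁)
    (τ₂ : Representation ℂ (Heisenberg (polar (Matrix.toLinearMap₂' P (1 : Matrix n n P)))) E₂)
    (h₁πu : ∀ (h : Heisenberg B) (v : E₁), ‖π₁ h v‖ = ‖v‖)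
    (h₁πc : ∀ v : E₁, Continuous fun y : X => π₁ ⟨y, 0⟩ v)
    (h₁πz : ∀ (t : R) (v : E₁), π₁ (Heisenberg.ofCenter B (Multiplicative.ofAdd t)) v = ((𝐞 (ℓ t) : Circle) : ℂ) • v)
    (h₁τu : ∀ (h : Heisenberg (polar (Matrix.toLinearMap₂' P (1 : Matrix n n P)))) (v : E₁), ‖τ₁ h v‖ = ‖v‖)
    (h₁τc : ∀ v : E₁, Continuous fun w : (n → P) × (n → P) => τ₁ ⟨w, 0⟩ v)
    (h₁τz : ∀ (t : P) (v : E₁), τ₁ (Heisenberg.ofCenter (polar (Matrix.toLinearMap₂' P (1 : Matrix n n P)))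
      (Multiplicative.ofAdd t)) v = ((prodChar ψ hψA t : Circle) : ℂ) • v)
    (h₁comm : ∀ (h : Heisenberg B) (h' : Heisenberg (polar (Matrix.toLinearMap₂' P (1 : Matrix n n P)))) (v : E₁),
      π₁ h (τ₁ h' v) = τ₁ h' (π₁ h v))
    (h₁i : ∀ K : Submodule ℂ E₁, IsClosed (K : Set E₁) → (∀ (h : Heisenberg B), ∀ v ∈ K, π₁ h v ∈ K) →
      (∀ (h' : Heisenberg (polar (Matrix.toLinearMap₂' P (1 : Matrix n n P)))), ∀ v ∈ K, τ₁ h' v ∈ K) → K = ⊥ ∨ K = ⊤)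
    (U₁ U₂ : E₁ ≃ₗᵢ[ℂ] E₂)
    (hU₁π : ∀ (h : Heisenberg B) (v : E₁), U₁ (π₁ h v) = π₂ h (U₁ v))
    (hU₁τ : ∀ (h' : Heisenberg (polar (Matrix.toLinearMap₂' P (1 : Matrix n n P)))) (v : E₁),
      U₁ (τ₁ h' v) = τ₂ h' (U₁ v))
    (hU₂π : ∀ (h : Heisenberg B) (v : E₁), U₂ (π₁ h v) = π₂ h (U₂ v))
    (hU₂τ : ∀ (h' : Heisenberg (polar (Matrix.toLinearMap₂' P (1 : Matrix n n P)))) (v : E₁),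
      U₂ (τ₁ h' v) = τ₂ h' (U₂ v)) :
    ∃ c : ℂ, ‖c‖ = 1 ∧ ∀ v : E₁, U₂ v = c • U₁ v := by
  haveI : Fact (∀ i, IsOpen (A i : Set (F i))) := ⟨isOpen_structureSubring hA⟩
  exact linearIsometryEquiv_unique_of_heisenberg_pair B ℓ (Matrix.toLinearMap₂' P (1 : Matrix n n P))
    (prodChar ψ hψA) hℓ hs (isDualLatticePair_integers_conductor_pi hA ψ hψc hψ1 hψA hunr)
    (exists_units_smul_integers_pi_subset hA hsmall) (exists_units_smul_conductor_pi_subset hA ψ hψc hψ1 hunr hsmall)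
    π₁ π₂ τ₁ τ₂ h₁πu h₁πc h₁πz h₁τu h₁τc h₁τz h₁comm h₁i U₁ U₂ hU₁π hU₁τ hU₂π hU₂τ

end Literature.RepresentationTheory.HeisenbergGroup

end
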